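import Mathlib
import HarnessLib
import Summits.HubbardSuperconductivity.HubbardSuperconductivity.Theorems.KLProgrammeKLRegimeEngineV8WithCR
import Summits.HubbardSuperconductivity.HubbardSuperconductivity.Theorems.KLProgrammeKLRegimeEngineV8DefsQ8
import Summits.HubbardSuperconductivity.HubbardSuperconductivity.Theorems.KLProgrammeKLRegimeEngineV8TowerExports

/-!
# K3 ENGINE package algebra for skeleton v2 (plan g18 (R55) §C (k1) / §J (R55c)): `EngConsts.withCE` and the raise relation `EngConsts.IsRaiseOf Q₀ Q`
# (only `CR` and `CE` may grow; every other row is `Q₀`'s) — the common import of the five class SUCCESSOR Steps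

Cell `gate-hubbard-kl`; text = the pen's turnkey prerender `HOME/planner-g18/EngineV8Raise.prerender.lean` (sha16 58704351f9e9dbbc, farm rc 0) minus its TEMPLATE section, filed by
seat hubbard-kl-k3c2-p1 g5 (the k3c2-p1 lineage owns the module per (R55.2)/(R55.17)).

Purpose: the five class Steps of skeleton v2 (`LevelsUStep`, `E5ShareStep`, `IsoTupleLineStep`, `PairTransferStep`, `TwoLegMomentsStep`) quantify their history over
`Q₀.withCR r` (`r ≥ Q₀.CR`); under token table B′ (`klEngQ9` = a CE-raise of `klEngQ8`) that family does not contain the stubs' package. Rev 2 of the five class files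
replaces `∀ r : ℝ, Q₀.CR ≤ r → …(Q₀.withCR r)…` by `∀ Q : EngConsts, Q₀.IsRaiseOf Q → …Q…` with the threshold still read at `Q.CR` — this module is their common import.

* `EngConsts.withCE Q e := { Q with CE := e }` + `rfl` rows; `withCR_withCE_comm`;
* `EngConsts.IsRaiseOf Q₀ Q : Prop := Q₀.CR ≤ Q.CR ∧ Q₀.CE ≤ Q.CE ∧ Q = (Q₀.withCR Q.CR).withCE Q.CE`;
* `isRaiseOf_refl`, `isRaiseOf_withCR` (`Q₀.CR ≤ r`), `isRaiseOf_withCR_withCE` (`Q₀.CR ≤ r`, `Q₀.CE ≤ e`), `IsRaiseOf.trans`, the pinned-row readers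
  `IsRaiseOf.c0_eq/cE4_eq/S'_eq/Bf_eq/SL_eq/CL_eq/L0_eq/M0_eq`, `IsRaiseOf.wf` (`Q₀.WF → Q.WF`), and `isRaiseOf_klEngQ8 : (klEngQ7 P R).IsRaiseOf (klEngQ8 P R)`.

Definitions with bodies + bookkeeping; nothing about the model is asserted; nothing asserts superconductivity.
-/

noncomputable section

namespace Summit.HubbardSuperconductivity.HubbardSuperconductivity.Theorems.KLRegimeSplit

set_option linter.dupNamespace false

/-- **`Q.withCE e`** — the engine package `Q` with `CE := e`, every other field untouched. -/
def EngConsts.withCE (Q : EngConsts) (e : ℝ) : EngConsts := { Q with CE := e }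

namespace EngConsts

variable (Q : EngConsts) (e r : ℝ)

/-- `(Q.withCE e).CE = e`. -/
@[simp] theorem withCE_CE : (Q.withCE e).CE = e := rfl
/-- untouched field `CR`. -/
@[simp] theorem withCE_CR : (Q.withCE e).CR = Q.CR := rfl
/-- untouched field `c0`. -/
@[simp] theorem withCE_c0 : (Q.withCE e).c0 = Q.c0 := rfl
/-- untouched field `cE4`. -/
@[simp] theorem withCE_cE4 : (Q.withCE e).cE4 = Q.cE4 := rfl
/-- untouched field `S'`. -/
@[simp] theorem withCE_S' : (Q.withCE e).S' = Q.S' := rfl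
/-- untouched field `Bf`. -/
@[simp] theorem withCE_Bf : (Q.withCE e).Bf = Q.Bf := rfl
/-- untouched field `SL`. -/
@[simp] theorem withCE_SL : (Q.withCE e).SL = Q.SL := rfl
/-- untouched field `CL`. -/
@[simp] theorem withCE_CL : (Q.withCE e).CL = Q.CL := rfl
/-- untouched field `L0`. -/
@[simp] theorem withCE_L0 : (Q.withCE e).L0 = Q.L0 := rfl
/-- untouched field `M0`. -/
@[simp] theorem withCE_M0 : (Q.withCE e).M0 = Q.M0 := rfl

/-- Replacing `CE` by itself does nothing. -/
theorem withCE_self : Q.withCE Q.CE = Q := rfl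

/-- The two single-field replacements commute. -/
theorem withCR_withCE_comm : (Q.withCR r).withCE e = (Q.withCE e).withCR r := rfl

/-- `(Q.withCR Q.CR).withCE Q.CE = Q`. -/
theorem withCR_withCE_self : (Q.withCR Q.CR).withCE Q.CE = Q := rfl

/-- Replacing `CE` by a nonnegative value preserves well-formedness. -/
theorem withCE_wf {Q : EngConsts} {e : ℝ} (hQ : Q.WF) (he : 0 ≤ e) : (Q.withCE e).WF := by
  obtain ⟨_, h2, h3, h4, h5, h6, h7, h8⟩ := hQ
  exact ⟨he, h2, h3, h4, h5, h6, h7, h8⟩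

/-- **`Q₀.IsRaiseOf Q`** — `Q` is `Q₀` with `CR` and `CE` (weakly) RAISED and every other row untouched. The class Steps of skeleton v2 quantify their history
over this family (rev 2), so that BOTH token tables (A: `klEngQ8` = a CR-raise of `klEngQ7`; B′: `klEngQ9` = a CE-raise of `klEngQ8`) are instances. -/
def IsRaiseOf (Q₀ Q : EngConsts) : Prop := Q₀.CR ≤ Q.CR ∧ Q₀.CE ≤ Q.CE ∧ Q = (Q₀.withCR Q.CR).withCE Q.CE

variable {Q e r}

/-- Every package is a (trivial) raise of itself. -/
theorem isRaiseOf_refl (Q₀ : EngConsts) : Q₀.IsRaiseOf Q₀ := ⟨le_rfl, le_rfl, rfl⟩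

/-- A pure `CR`-raise is a raise (the v2 table-A instance shape; the rev-1 Steps' family). -/
theorem isRaiseOf_withCR {Q₀ : EngConsts} {r : ℝ} (hr : Q₀.CR ≤ r) : Q₀.IsRaiseOf (Q₀.withCR r) := ⟨hr, le_rfl, rfl⟩

/-- A `CR`-raise followed by a `CE`-raise is a raise (the table-B′ instance shape). -/
theorem isRaiseOf_withCR_withCE {Q₀ : EngConsts} {r e : ℝ} (hr : Q₀.CR ≤ r) (he : Q₀.CE ≤ e) : Q₀.IsRaiseOf ((Q₀.withCR r).withCE e) :=
  ⟨hr, he, rfl⟩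

namespace IsRaiseOf

variable {Q₀ Q Q' : EngConsts}

/-- `Q₀.CR ≤ Q.CR`. -/
theorem CR_le (h : Q₀.IsRaiseOf Q) : Q₀.CR ≤ Q.CR := h.1
/-- `Q₀.CE ≤ Q.CE`. -/
theorem CE_le (h : Q₀.IsRaiseOf Q) : Q₀.CE ≤ Q.CE := h.2.1
/-- The raised package IS `(Q₀.withCR Q.CR).withCE Q.CE` (all other rows pinned). -/
theorem eq (h : Q₀.IsRaiseOf Q) : Q = (Q₀.withCR Q.CR).withCE Q.CE := h.2.2

/-- pinned row `c0`. -/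
theorem c0_eq (h : Q₀.IsRaiseOf Q) : Q.c0 = Q₀.c0 := by rw [h.eq]; rfl
/-- pinned row `cE4`. -/
theorem cE4_eq (h : Q₀.IsRaiseOf Q) : Q.cE4 = Q₀.cE4 := by rw [h.eq]; rfl
/-- pinned row `S'`. -/
theorem S'_eq (h : Q₀.IsRaiseOf Q) : Q.S' = Q₀.S' := by rw [h.eq]; rfl
/-- pinned row `Bf`. -/
theorem Bf_eq (h : Q₀.IsRaiseOf Q) : Q.Bf = Q₀.Bf := by rw [h.eq]; rfl
/-- pinned row `SL`. -/
theorem SL_eq (h : Q₀.IsRaiseOf Q) : Q.SL = Q₀.SL := by rw [h.eq]; rfl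
/-- pinned row `CL`. -/
theorem CL_eq (h : Q₀.IsRaiseOf Q) : Q.CL = Q₀.CL := by rw [h.eq]; rfl
/-- pinned row `L0`. -/
theorem L0_eq (h : Q₀.IsRaiseOf Q) : Q.L0 = Q₀.L0 := by rw [h.eq]; rfl
/-- pinned row `M0`. -/
theorem M0_eq (h : Q₀.IsRaiseOf Q) : Q.M0 = Q₀.M0 := by rw [h.eq]; rfl

/-- Raises compose. -/
theorem trans (h : Q₀.IsRaiseOf Q) (h' : Q.IsRaiseOf Q') : Q₀.IsRaiseOf Q' := by
  refine ⟨h.1.trans h'.1, h.2.1.trans h'.2.1, ?_⟩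
  rw [h'.eq, h.eq]
  rfl

/-- A raise of a well-formed package is well formed (`CR`, `CE` only grow from nonnegative values). -/
theorem wf (h : Q₀.IsRaiseOf Q) (h₀ : Q₀.WF) : Q.WF := by
  rw [h.eq]
  exact withCE_wf (withCR_wf_of_le h₀ h.1) (h₀.1.trans h.2.1)

/-- `Q` is the `CR`-raise `Q₀.withCR Q.CR` exactly when its `CE` row is untouched — the bridge back to the rev-1 Step family. -/
theorem eq_withCR_of_CE_eq (h : Q₀.IsRaiseOf Q) (hCE : Q.CE = Q₀.CE) : Q = Q₀.withCR Q.CR := by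
  rw [h.eq, hCE]; rfl

end IsRaiseOf

end EngConsts

end Summit.HubbardSuperconductivity.HubbardSuperconductivity.Theorems.KLRegimeSplit

namespace Summit.HubbardSuperconductivity.HubbardSuperconductivity.Theorems.EngineV8

set_option linter.dupNamespace false

open Summit.HubbardSuperconductivity.HubbardSuperconductivity.Theorems.KLRegimeSplit

/-- **Token table A is an instance**: `klEngQ8 P R` (a pure `CR`-raise of `klEngQ7 P R`) is a raise of `klEngQ7 P R`. -/
theorem isRaiseOf_klEngQ8 (P : SplitConsts) (R : RenConsts) : (klEngQ7 P R).IsRaiseOf (klEngQ8 P R) :=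
  EngConsts.isRaiseOf_withCR (klEngQ7_CR_le_klEngQ8_CR P R)

end Summit.HubbardSuperconductivity.HubbardSuperconductivity.Theorems.EngineV8

end
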